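import Literature.MathematicalPhysics.QuantumFieldTheory.Balaban1983to89.B7Prop7Ck
import Literature.MathematicalPhysics.QuantumFieldTheory.Balaban1983to89.B7Eq123BackgroundModulus

/-!
# `Balaban1983to89.B7Prop7BackgroundModulusLevels` — T. Bałaban, *Averaging operations for lattice gauge theories*, Commun. Math. Phys. **98** (1985) 17–51
# [Balaban1985Averaging] Proposition 7 p. 43 («the function Q_k(U′U₀, ηA) is analytic in complex variables A′, A, and Proposition 4 holds uniformly in A′»)
# with Proposition 4 (130)–(131), (134) p. 38: **THE `k`-LEVEL COMPOSITE AVERAGE `Q_k(V, A)` AND ITS LINEAR PART `LᵏηQ_k(V)A` ARE LIPSCHITZ IN THE BACKGROUND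
# AT THE FLAT POINT, UNIFORMLY IN THE NUMBER OF LEVELS** — for a background `V` with `‖V(b) − 1‖ ≤ ε` and a field `‖A(b)‖ ≤ b` in Prop. 7's polydisc regime
# (`Lᵏρ′`, `Lᵏρ` small): `‖Q_k(V, A)(c) − Q_k(1, A)(c)‖ ≤ (12∕(Lᵏρ′))·(Lᵏε)·(Lᵏb)` and the same for the linear part — the `k`-level twin of ne9-leaf-04's
# `B7Eq123BackgroundModulus.norm_Qcov_sub_flat_le` (ONE step): a CAUCHY ESTIMATE along `τ ↦ e^{τ log V}` on Prop. 7's analyticity in the background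
# (`B7Prop7Levels.prop7_analyticAt` in family form) with the uniform bound (131) (`prop7_prop4_uniform`); the linear part as the derivative at `A = 0` along `s ↦ sA`
# (general-direction twin of `B7Prop7Ck.hasDerivAt_logCovIter_cplx_ins_dir`, from (130)) followed by the Cauchy estimate for a derivative.  The LATTICE-FREE form:
# on the diagonal `ηLᵏ = 1` of the NE9 chain `Lᵏε = α` (print's window `‖U(b) − 1‖ ≤ αη`) — the brick `δ_C` of the chain's Sect. C letter at the tower.  NE9 crux-team
# LEAF PROVER 01 (`b2b-balaban-t4-ne9-formalise-leaf-01`), gen 104; cell `pub-balaban`∕`t4`, row NE9, bears_on R4/N22; source READ first-hand (pp. 36–39, 43) through the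
# verbatim quotations of `B7Prop7Ins` ∕ `B7Prop7Ck`; composition BY NAME; nothing printed is a hypothesis beyond Prop. 7's regime DISPLAYED as the five smallness inequalities.
# WHAT IS PROVED (sorry-free; 0 `def`): `hasDerivAt_logCovIter_line` ((134) at `A = 0` along a complex line, any direction), **`norm_logCovIter_sub_flat_le`**,
# **`norm_linCovIter_sub_flat_le`**.  HONEST SCOPE: [folklore] Cauchy estimates on LANDED analyticity ∕ bounds; crude constants; the flat base only (`U₀ = 1`);
# «NE9 ⇐ the named binders»; NE9 NOT PRINTED ∕ NOT PROVED; spine PROVED 0∕9; rung (B)+1 finite T⁴ — NOT infinite volume, NOT mass gap, NOT BetaPertH, NOT Clay.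
# HONEST DEPENDENCY: continuum YM on T⁴ ⇐ BetaPertH ∧ nine spine estimates (0/9 proved); BetaPertH ⇐ (D1) ∧ (D4) ∧ CAP+tail; G-an2-4 gates asym, D1 and NE2/3/4.

statement-level skeleton of published theorems with citation tags; proofs where landed; nothing here is a claim about the Yang–Mills mass gap
-/

noncomputable section

open scoped BigOperators
open NormedSpace Metric Set

namespace Literature.MathematicalPhysics.QuantumFieldTheory.Balaban1983to89.B7Prop7BackgroundModulusLevels

open B7Prop1Explicit B7Prop2Explicit B7Prop3Flat MatrixLog B7Prop3GeneralLinear B7Prop4GeneralLevels B7Prop7Levels B7Prop7Ins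
open B7Prop4GeneralCk (logCovIter_zero_field)
open B7Prop7Ck (linCovIter_cplx_csmul)
open B7Eq123BackgroundModulus (expCfg_zero' expCfg_mlog)
open B13Contraction113 (norm_sub_le_of_sphere_bound)

export B7Prop1Explicit (Site)

variable {d : ℕ} {𝔸 : Type*} [NormedRing 𝔸] [NormedAlgebra ℂ 𝔸] [CompleteSpace 𝔸] [NormOneClass 𝔸]
  (L : ℕ) (hL : 2 ≤ L) {G : Subgroup 𝔸ˣ} (hG : AvgClosed d L G) (k : ℕ) {α₀ : ℝ} (hα : 0 < α₀)
  (hα3 : C0 d * α₀ ≤ 1 / 3) (hα8 : 8 * α₀ ≤ c2' d L)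
  {ρ' ρ : ℝ} (hρ' : 0 < ρ') (hρ : 0 < ρ)
  (hsmall' : Real.exp (4 * (800 * ((d : ℝ) + 1) ^ 2 * ((d : ℝ) + 4)) * α₀)
    * (1 + 8 * (131072 * ((d : ℝ) + 1) ^ 2) * ((L : ℝ) ^ k * ρ')) ≤ 2)
  (hc₃' : 2 * ((L : ℝ) ^ k * ρ') ≤ c3 d L) (hρ'1 : 409600 * ((d : ℝ) + 1) ^ 2 * ((L : ℝ) ^ k * ρ') ≤ 1)
  (hsmall : Real.exp (4480 * ((d : ℝ) + 1) ^ 2 * ((d : ℝ) + 4) * α₀ + 240000 * ((d : ℝ) + 1) ^ 3 * ((L : ℝ) ^ k * ρ'))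
    * (1 + 8 * (2097152 * ((d : ℝ) + 1) ^ 2) * ((L : ℝ) ^ k * ρ)) ≤ 2)
  (hc₃ : 2 * ((L : ℝ) ^ k * ρ) ≤ c3 d L / 4)

omit [NormedAlgebra ℂ 𝔸] [CompleteSpace 𝔸] [NormOneClass 𝔸] in
/-- (52) at the vacuum: the plaquette deviation of `1` vanishes. [cite: Balaban1985Averaging, Proposition 2 (52) p.26, (9) p.18] -/
private theorem hol_one : ∀ (x : Site d) (w : List (B7Prop1Explicit.Letter d)), hol (1 : Site d → Fin d → 𝔸ˣ) x w = 1
  | _, [] => rfl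
  | x, l :: w => by rw [B7Prop1Explicit.hol_cons, hol_one (x + l.vec) w, mul_one]; simp [stepHol]

omit [NormedAlgebra ℂ 𝔸] [CompleteSpace 𝔸] [NormOneClass 𝔸] in
include hL hα in
/-- (52) holds at `U₀ = 1` for every `α₀ > 0`. [cite: Balaban1985Averaging, Proposition 2 (52) p.26] -/
private theorem pdev_one_lt : pdev (1 : Site d → Fin d → 𝔸ˣ) < α₀ * (((L : ℝ) ^ k)⁻¹) ^ 2 := by
  have hpdev : pdev (1 : Site d → Fin d → 𝔸ˣ) = 0 := by unfold pdev; simp [hol_one]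
  rw [hpdev]
  have : (0 : ℝ) < L := by exact_mod_cast (lt_of_lt_of_le (by norm_num) hL : 0 < L)
  positivity

/-! ## §1 (134) at `A = 0` along a complex line, any direction, at the complex background `e^{B′}·1` -/

include hL hG hα hα3 hα8 hρ hsmall' hc₃' hρ'1 hsmall hc₃ in
/-- **`d∕ds Q_k(e^{B′}, sD)(c)|_{s=0} = LᵏηQ_k(e^{B′})D(c)`** for every direction `D` with `‖D(b)‖ ≤ δ` — (130) along the line `s ↦ sD` (`‖Q_k − LᵏηQ_k(·)(sD)‖ ≤
8C₁′e^{E}(Lᵏ|s|δ)²`) and the homogeneity `linCovIter_cplx_csmul`; the general-direction twin of `B7Prop7Ck.hasDerivAt_logCovIter_cplx_ins_dir`. [folklore]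
[cite: Balaban1985Averaging, Proposition 7 p.43, (130) p.38, (134) p.38] -/
theorem hasDerivAt_logCovIter_line (B' : Site d → Fin d → 𝔸) {b' : ℝ} (hb' : 0 ≤ b') (hB' : ∀ x κ, ‖B' x κ‖ ≤ b') (hb'ρ : b' ≤ ρ')
    (D : Site d → Fin d → 𝔸) {δ : ℝ} (hδ : 0 ≤ δ) (hD : ∀ x κ, ‖D x κ‖ ≤ δ) (z : Site d) (κ : Fin d) :
    HasDerivAt (fun t : ℂ => logCovIter L (expCfg B' * 1) (t • D) k z κ) (linCovIter L (expCfg B' * 1) D k z κ) 0 := by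
  obtain ⟨hs', hc', h1', -, -⟩ := smallness7_mono (d := d) (L := L) (k := k) (α₀ := α₀) hb'ρ le_rfl hρ.le hsmall' hc₃' hρ'1 hsmall hc₃
  have hU₀ : ∀ (x : Site d) (κ' : Fin d), (1 : Site d → Fin d → 𝔸ˣ) x κ' ∈ G := fun _ _ => G.one_mem
  have h52 := pdev_one_lt (d := d) (𝔸 := 𝔸) L hL k hα
  set K : ℝ := 8 * (2097152 * ((d : ℝ) + 1) ^ 2)
    * Real.exp (4480 * ((d : ℝ) + 1) ^ 2 * ((d : ℝ) + 4) * α₀ + 240000 * ((d : ℝ) + 1) ^ 3 * ((L : ℝ) ^ k * b')) with hK_def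
  have hK0 : 0 ≤ K := by positivity
  rw [hasDerivAt_iff_isLittleO_nhds_zero]
  have h0 : logCovIter L (expCfg B' * 1) ((0 : ℂ) • D) k z κ = 0 := by
    rw [zero_smul, logCovIter_zero_field L (expCfg B' * 1) k]; rfl
  refine (Asymptotics.IsBigO.of_bound (K * ((L : ℝ) ^ k * δ) ^ 2) ?_).trans_isLittleO (Asymptotics.isLittleO_pow_id (one_lt_two))
  rw [Metric.eventually_nhds_iff]
  refine ⟨ρ / (δ + 1), by positivity, fun h hh => ?_⟩
  rw [dist_zero_right] at hh
  have hb : ‖h‖ * δ ≤ ρ := by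
    have hv1 : (0 : ℝ) < δ + 1 := by positivity
    have h1 : ‖h‖ * (δ + 1) ≤ ρ := ((lt_div_iff₀ hv1).1 hh).le
    nlinarith [norm_nonneg h]
  obtain ⟨-, -, -, hs, hc⟩ := smallness7_mono (d := d) (L := L) (k := k) (α₀ := α₀) hb'ρ (mul_nonneg (norm_nonneg h) hδ) hb hsmall' hc₃' hρ'1 hsmall hc₃
  have hbnd : ∀ x κ', ‖(h • D) x κ'‖ ≤ ‖h‖ * δ := fun x κ' => by
    rw [Pi.smul_apply, Pi.smul_apply, norm_smul]; exact mul_le_mul_of_nonneg_left (hD x κ') (norm_nonneg h)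
  have hE := (prop7_prop4_uniform L hL hG k 1 hU₀ hα hα3 hα8 h52 B' hb' hB' hs' hc' h1' (h • D) (by positivity) hbnd hs hc k le_rfl).1
  have hlin : h • linCovIter L (expCfg B' * 1) D k z κ = linCovIter L (expCfg B' * 1) (h • D) k z κ := by
    rw [linCovIter_cplx_csmul L hL hG k 1 hU₀ hα hα3 hα8 h52 B' hb' hB' hs' hc' h1' h D k le_rfl, Pi.smul_apply, Pi.smul_apply]
  rw [zero_add, h0, sub_zero, hlin, norm_pow]
  calc ‖logCovIter L (expCfg B' * 1) (h • D) k z κ - linCovIter L (expCfg B' * 1) (h • D) k z κ‖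
      ≤ K * ((L : ℝ) ^ k * (‖h‖ * δ)) ^ 2 := by rw [hK_def]; exact hE z κ
    _ = K * ((L : ℝ) ^ k * δ) ^ 2 * ‖h‖ ^ 2 := by ring

/-! ## §2 The composite average is Lipschitz in the background at the flat point, uniformly in `k` -/

include hL hG hα hα3 hα8 hρ' hsmall' hc₃' hρ'1 hsmall hc₃ in
/-- **`‖Q_k(V, A)(c) − Q_k(1, A)(c)‖ ≤ (12∕(Lᵏρ′))·(Lᵏε)·(Lᵏb)`** for `‖V(b) − 1‖ ≤ ε` with `6ε ≤ ρ′` and `‖A(b)‖ ≤ b ≤ ρ` — Prop. 7's analyticity in the background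
read as a Lipschitz modulus at the vacuum: `h(τ) = Q_k(e^{τ log V}, A)(c)` is analytic on `|τ| < R := ρ′∕(2ε)` (`B7Prop7Levels.prop7_analyticAt`, family `τ ↦ τ·log V`,
`|log V| ≤ 2ε`) with the uniform bound (131) `‖h(τ)‖ ≤ 2Lᵏb`; Cauchy on circles of radius `R − 2` around `[0,1]` (`B13Contraction113.norm_sub_le_of_sphere_bound`),
`2Lᵏb∕(R − 2) ≤ 6Lᵏb∕R`. [folklore] [cite: Balaban1985Averaging, Proposition 7 p.43, (131) p.38, (127) p.37] -/
theorem norm_logCovIter_sub_flat_le (V : Site d → Fin d → 𝔸ˣ) {ε : ℝ} (hε : 0 ≤ ε) (hVε : ∀ x κ, ‖((V x κ : 𝔸ˣ) : 𝔸) - 1‖ ≤ ε) (hερ : 6 * ε ≤ ρ')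
    (A : Site d → Fin d → 𝔸) {b : ℝ} (hb : 0 ≤ b) (hA : ∀ x κ, ‖A x κ‖ ≤ b) (hbρ : b ≤ ρ) (z : Site d) (κ : Fin d) :
    ‖logCovIter L V A k z κ - logCovIter L 1 A k z κ‖ ≤ 12 / ((L : ℝ) ^ k * ρ') * ((L : ℝ) ^ k * ε) * ((L : ℝ) ^ k * b) := by
  have hLk : (0 : ℝ) < (L : ℝ) ^ k := pow_pos (by exact_mod_cast (lt_of_lt_of_le (by norm_num) hL : 0 < L)) k
  rcases hε.eq_or_lt with h0 | hpos
  · -- `ε = 0`: the background IS flat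
    have hV1 : V = 1 := by
      funext x κ'
      have h := hVε x κ'
      rw [← h0] at h
      exact Units.ext (by simpa [sub_eq_zero] using norm_le_zero_iff.1 h)
    rw [hV1, sub_self, norm_zero, ← h0]; positivity
  have hU₀ : ∀ (x : Site d) (κ' : Fin d), (1 : Site d → Fin d → 𝔸ˣ) x κ' ∈ G := fun _ _ => G.one_mem
  have h52 := pdev_one_lt (d := d) (𝔸 := 𝔸) L hL k hα
  obtain ⟨-, -, -, hs, hc⟩ := smallness7_mono (d := d) (L := L) (k := k) (α₀ := α₀) le_rfl hb hbρ hsmall' hc₃' hρ'1 hsmall hc₃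
  -- the logarithm of the background
  have hε1 : ρ' ≤ 1 / 2 := by
    have h1 : (1 : ℝ) ≤ (L : ℝ) ^ k := one_le_pow₀ (by exact_mod_cast le_trans (by norm_num) hL)
    have h2 : (1 : ℝ) ≤ ((d : ℝ) + 1) ^ 2 := one_le_pow₀ (by linarith [(Nat.cast_nonneg d : (0 : ℝ) ≤ d)])
    have h3 : ρ' ≤ (L : ℝ) ^ k * ρ' := le_mul_of_one_le_left hρ'.le h1
    have h4 : (L : ℝ) ^ k * ρ' ≤ ((d : ℝ) + 1) ^ 2 * ((L : ℝ) ^ k * ρ') := le_mul_of_one_le_left (by positivity) h2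
    linarith
  have hε2 : ε ≤ 1 / 2 := by linarith
  set X : Site d → Fin d → 𝔸 := fun x κ' => mlog ((V x κ' : 𝔸ˣ) : 𝔸) with hXdef
  have hX : ∀ x κ', ‖X x κ'‖ ≤ 2 * ε := fun x κ' => (norm_mlog_le_two_mul ((hVε x κ').trans hε2)).trans (by linarith [hVε x κ'])
  have hVexp : expCfg X = V := expCfg_mlog V fun x κ' => (hVε x κ').trans_lt (by linarith)
  -- the radius of analyticity in the background variable
  set R : ℝ := ρ' / (2 * ε) with hRdef
  have hR : 0 < R := by rw [hRdef]; positivity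
  have hR3 : 3 ≤ R := by rw [hRdef, le_div_iff₀ (by positivity)]; linarith
  have hRε : 2 * R * ε = ρ' := by rw [hRdef]; field_simp
  -- the family `h(τ) = Q_k(e^{τX}, A)(c)`
  set h : ℂ → 𝔸 := fun τ => logCovIter L (expCfg (τ • X) * 1) A k z κ with hhdef
  have h1 : h 1 = logCovIter L V A k z κ := by simp only [hhdef, one_smul, hVexp, mul_one]
  have h0' : h 0 = logCovIter L 1 A k z κ := by simp only [hhdef, zero_smul, expCfg_zero', mul_one]
  have hτX : ∀ τ : ℂ, ‖τ‖ < R → ∀ x κ', ‖(τ • X) x κ'‖ ≤ ρ' := fun τ hτ x κ' => by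
    rw [Pi.smul_apply, Pi.smul_apply, norm_smul]
    calc ‖τ‖ * ‖X x κ'‖ ≤ R * (2 * ε) := mul_le_mul hτ.le (hX x κ') (norm_nonneg _) hR.le
      _ = ρ' := by rw [← hRε]; ring
  -- analyticity on the disc
  have hd : DifferentiableOn ℂ h (ball (0 : ℂ) R) := fun τ hτ => by
    rw [mem_ball_zero_iff] at hτ
    have han := prop7_analyticAt L hL hG k 1 hU₀ hα hα3 hα8 h52 (E := ℂ) (fun t : ℂ => t • X) (t₀ := τ)
      (fun x κ' => (analyticAt_id.smul analyticAt_const : AnalyticAt ℂ (fun t : ℂ => (t • X) x κ') τ)) hρ'.le (hτX τ hτ)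
      hsmall' hc₃' hρ'1 (fun _ : ℂ => A) (fun x κ' => analyticAt_const) hb hA hs hc k le_rfl z κ
    exact han.differentiableAt.differentiableWithinAt
  -- the uniform bound (131) on the disc
  have hM : ∀ τ : ℂ, ‖τ‖ < R → ‖h τ‖ ≤ 2 * ((L : ℝ) ^ k * b) := fun τ hτ =>
    (prop7_prop4_uniform L hL hG k 1 hU₀ hα hα3 hα8 h52 (τ • X) hρ'.le (hτX τ hτ) hsmall' hc₃' hρ'1 A hb hA hs hc k le_rfl).2 z κ
  -- Cauchy on circles of radius `R − 2` around `[0, 1]`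
  have hr : 0 < R - 2 := by linarith
  have hsub : ∀ t : ℝ, t ∈ Icc (0 : ℝ) 1 → closedBall (t : ℂ) (R - 2) ⊆ ball (0 : ℂ) R := fun t ht w hw => by
    rw [mem_closedBall, dist_eq_norm] at hw
    rw [mem_ball_zero_iff]
    have ht1 : ‖(t : ℂ)‖ ≤ 1 := by rw [Complex.norm_real, Real.norm_of_nonneg ht.1]; exact ht.2
    calc ‖w‖ = ‖(w - t) + t‖ := by rw [sub_add_cancel]
      _ ≤ ‖w - (t : ℂ)‖ + ‖(t : ℂ)‖ := norm_add_le _ _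
      _ < R := by linarith
  have hMs : ∀ t : ℝ, t ∈ Icc (0 : ℝ) 1 → ∀ w ∈ sphere (t : ℂ) (R - 2), ‖h w‖ ≤ 2 * ((L : ℝ) ^ k * b) := fun t ht w hw =>
    hM w (mem_ball_zero_iff.1 (hsub t ht (sphere_subset_closedBall hw)))
  have hC := norm_sub_le_of_sphere_bound isOpen_ball hd hr hsub hMs
  rw [h1, h0'] at hC
  refine hC.trans ?_
  have hR2 : R / 3 ≤ R - 2 := by linarith
  have hMnn : 0 ≤ 2 * ((L : ℝ) ^ k * b) := by positivity
  calc 2 * ((L : ℝ) ^ k * b) / (R - 2) ≤ 2 * ((L : ℝ) ^ k * b) / (R / 3) := div_le_div_of_nonneg_left hMnn (by positivity) hR2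
    _ = 12 / ((L : ℝ) ^ k * ρ') * ((L : ℝ) ^ k * ε) * ((L : ℝ) ^ k * b) := by rw [hRdef]; field_simp; ring

/-! ## §3 The linear part is Lipschitz in the background at the flat point, uniformly in `k` -/

include hL hG hα hα3 hα8 hρ' hρ hsmall' hc₃' hρ'1 hsmall hc₃ in
/-- **`‖LᵏηQ_k(V)A(c) − LᵏηQ_k(1)A(c)‖ ≤ (12∕(Lᵏρ′))·(Lᵏε)·(Lᵏb)`** under the same regime — the linear part is the derivative at `s = 0` of
`F(s) = Q_k(V, sA)(c) − Q_k(1, sA)(c)` (§1), `F` is analytic on `|s| ≤ 1` (Prop. 7 in the field family `s ↦ sA`) and bounded there by §2 at the field `sA`; Cauchy's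
estimate for the derivative on the unit circle (`Complex.norm_deriv_le_of_forall_mem_sphere_norm_le`). [folklore]
[cite: Balaban1985Averaging, Proposition 7 p.43, (130)–(131) p.38, (134) p.38] -/
theorem norm_linCovIter_sub_flat_le (V : Site d → Fin d → 𝔸ˣ) {ε : ℝ} (hε : 0 ≤ ε) (hVε : ∀ x κ, ‖((V x κ : 𝔸ˣ) : 𝔸) - 1‖ ≤ ε) (hερ : 6 * ε ≤ ρ')
    (A : Site d → Fin d → 𝔸) {b : ℝ} (hb : 0 ≤ b) (hA : ∀ x κ, ‖A x κ‖ ≤ b) (hbρ : 2 * b ≤ ρ) (z : Site d) (κ : Fin d) :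
    ‖linCovIter L V A k z κ - linCovIter L 1 A k z κ‖ ≤ 12 / ((L : ℝ) ^ k * ρ') * ((L : ℝ) ^ k * ε) * ((L : ℝ) ^ k * b) := by
  have hLk : (0 : ℝ) < (L : ℝ) ^ k := pow_pos (by exact_mod_cast (lt_of_lt_of_le (by norm_num) hL : 0 < L)) k
  have hU₀ : ∀ (x : Site d) (κ' : Fin d), (1 : Site d → Fin d → 𝔸ˣ) x κ' ∈ G := fun _ _ => G.one_mem
  have h52 := pdev_one_lt (d := d) (𝔸 := 𝔸) L hL k hα
  have hbρ' : b ≤ ρ := by linarith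
  -- the two backgrounds in the exponential chart: `V = e^{X}·1`, `1 = e^{0}·1`
  have hε1 : ρ' ≤ 1 / 2 := by
    have h1 : (1 : ℝ) ≤ (L : ℝ) ^ k := one_le_pow₀ (by exact_mod_cast le_trans (by norm_num) hL)
    have h2 : (1 : ℝ) ≤ ((d : ℝ) + 1) ^ 2 := one_le_pow₀ (by linarith [(Nat.cast_nonneg d : (0 : ℝ) ≤ d)])
    have h3 : ρ' ≤ (L : ℝ) ^ k * ρ' := le_mul_of_one_le_left hρ'.le h1
    have h4 : (L : ℝ) ^ k * ρ' ≤ ((d : ℝ) + 1) ^ 2 * ((L : ℝ) ^ k * ρ') := le_mul_of_one_le_left (by positivity) h2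
    linarith
  have hε2 : ε ≤ 1 / 2 := by linarith
  set X : Site d → Fin d → 𝔸 := fun x κ' => mlog ((V x κ' : 𝔸ˣ) : 𝔸) with hXdef
  have hX : ∀ x κ', ‖X x κ'‖ ≤ 2 * ε := fun x κ' => (norm_mlog_le_two_mul ((hVε x κ').trans hε2)).trans (by linarith [hVε x κ'])
  have hX' : ∀ x κ', ‖X x κ'‖ ≤ ρ' := fun x κ' => (hX x κ').trans (by linarith)
  have hVexp : expCfg X * 1 = V := by rw [mul_one]; exact expCfg_mlog V fun x κ' => (hVε x κ').trans_lt (by linarith)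
  have h1exp : expCfg (0 : Site d → Fin d → 𝔸) * 1 = 1 := by rw [expCfg_zero', mul_one]
  have h0' : ∀ x κ', ‖(0 : Site d → Fin d → 𝔸) x κ'‖ ≤ 0 := fun _ _ => by simp
  -- `F(s) = Q_k(V, sA) − Q_k(1, sA)` and its derivative at `0`
  set F : ℂ → 𝔸 := fun s => logCovIter L (expCfg X * 1) (s • A) k z κ - logCovIter L (expCfg 0 * 1) (s • A) k z κ with hFdef
  have hderiv : HasDerivAt F (linCovIter L (expCfg X * 1) A k z κ - linCovIter L (expCfg (0 : Site d → Fin d → 𝔸) * 1) A k z κ) 0 :=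
    (hasDerivAt_logCovIter_line L hL hG k hα hα3 hα8 hρ hsmall' hc₃' hρ'1 hsmall hc₃ X (by positivity) hX' le_rfl A hb hA z κ).sub
      (hasDerivAt_logCovIter_line L hL hG k hα hα3 hα8 hρ hsmall' hc₃' hρ'1 hsmall hc₃ 0 le_rfl h0' hρ'.le A hb hA z κ)
  -- analyticity of `F` on the closed unit disc (field `sA`, `‖sA‖ ≤ b ≤ ρ` for `|s| ≤ 1`... with room `2b ≤ ρ`)
  have hsA : ∀ s : ℂ, ‖s‖ ≤ 2 → ∀ x κ', ‖(s • A) x κ'‖ ≤ 2 * b := fun s hs x κ' => by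
    rw [Pi.smul_apply, Pi.smul_apply, norm_smul]; exact mul_le_mul hs (hA x κ') (norm_nonneg _) (by norm_num)
  obtain ⟨-, -, -, hs2, hc2⟩ := smallness7_mono (d := d) (L := L) (k := k) (α₀ := α₀) le_rfl (by positivity : (0 : ℝ) ≤ 2 * b) hbρ hsmall' hc₃' hρ'1 hsmall hc₃
  have hdiff : ∀ (B' : Site d → Fin d → 𝔸), (∀ x κ', ‖B' x κ'‖ ≤ ρ') →
      DifferentiableOn ℂ (fun s : ℂ => logCovIter L (expCfg B' * 1) (s • A) k z κ) (closedBall (0 : ℂ) 2) := fun B' hB' s hs => by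
    rw [mem_closedBall_zero_iff] at hs
    have han := prop7_analyticAt L hL hG k 1 hU₀ hα hα3 hα8 h52 (E := ℂ) (fun _ : ℂ => B') (t₀ := s) (fun x κ' => analyticAt_const) hρ'.le hB'
      hsmall' hc₃' hρ'1 (fun t : ℂ => t • A) (fun x κ' => (analyticAt_id.smul analyticAt_const : AnalyticAt ℂ (fun t : ℂ => (t • A) x κ') s))
      (by positivity : (0 : ℝ) ≤ 2 * b) (hsA s hs) hs2 hc2 k le_rfl z κ
    exact han.differentiableAt.differentiableWithinAt
  have hFd : DiffContOnCl ℂ F (ball (0 : ℂ) 1) := by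
    refine DifferentiableOn.diffContOnCl ?_
    rw [closure_ball (0 : ℂ) one_ne_zero]
    exact ((hdiff X hX').mono (closedBall_subset_closedBall (by norm_num))).sub ((hdiff 0 (fun x κ' => (h0' x κ').trans hρ'.le)).mono
      (closedBall_subset_closedBall (by norm_num)))
  -- the bound on the unit circle: §2 at the field `sA`
  have hFb : ∀ s ∈ sphere (0 : ℂ) 1, ‖F s‖ ≤ 12 / ((L : ℝ) ^ k * ρ') * ((L : ℝ) ^ k * ε) * ((L : ℝ) ^ k * b) := fun s hs => by
    rw [mem_sphere_zero_iff_norm] at hs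
    have hsA1 : ∀ x κ', ‖(s • A) x κ'‖ ≤ b := fun x κ' => by rw [Pi.smul_apply, Pi.smul_apply, norm_smul, hs, one_mul]; exact hA x κ'
    have h := norm_logCovIter_sub_flat_le L hL hG k hα hα3 hα8 hρ' hsmall' hc₃' hρ'1 hsmall hc₃ V hε hVε hερ (s • A) hb hsA1 hbρ' z κ
    rw [hFdef]; dsimp only; rw [hVexp, h1exp]; exact h
  have hC := Complex.norm_deriv_le_of_forall_mem_sphere_norm_le one_pos hFd hFb
  rw [hderiv.deriv, div_one, hVexp, h1exp] at hC
  exact hC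

end Literature.MathematicalPhysics.QuantumFieldTheory.Balaban1983to89.B7Prop7BackgroundModulusLevels

end
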